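import Literature.AlgebraicTopology.KTheory.Exactness
import Literature.AlgebraicTopology.KTheory.Products
import HarnessLib

/-!
# Injectivity of `q^* : K̃((X × Y)/(X ∨ Y)) → K⁰(X × Y)`

A complement to the exact sequence `K̃(Z/A) → K⁰(Z) → K⁰(A)` of `Exactness.lean` (Hatcher,
*Vector Bundles and K-Theory*, Prop. 2.9 and the split exactness (2.7)/p. 55 for products;
Husemöller, *Fibre Bundles*, Ch. 10 Prop. 2.1, Ch. 11 §1): the left-hand map `q^*` is
*injective* on `K̃(Z/A)` as soon as every invertible matrix of functions on `A` extends to an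
invertible matrix of functions on `Z` (`eq_zero_of_quotK_eq_zero`). In the classical sequence
`K̃(SZ) → K̃(SA) → K̃(Z/A) → K⁰(Z)` this hypothesis says that `K̃(SZ) → K̃(SA)` is onto already on
the level of clutching functions; it holds for the **wedge** `A = X ∨ Y = X × {y₀} ∪ {x₀} × Y`
inside a product `Z = X × Y` (`exists_extend_prodWedge`: `G(x, y) = g(x, y₀) g(x₀, y₀)⁻¹ g(x₀, y)`),
which is the case used to pass from Bott periodicity for `X × S²` to the smash product
`X ∧ S²` and to spheres (Hatcher, *VBKT*, proof of Thm. 2.11 from (2.7); Husemöller, Ch. 11 §1,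
Cor. 1.4).

* §1 `algEquivalent_one_of_quot`, `eq_zero_of_quotK_eq_zero` — the criterion (purely algebraic:
  re-trivialise `q^* p ∼ 1` by the extended transition matrix so that the frames become constant
  on `A`, then descend them to `Z/A` with `descendMatrix`);
* §2 `prodWedge x₀ y₀ ⊆ X × Y`, `exists_extend_prodWedge`, and the consequences
  `eq_zero_of_quotK_prodWedge_eq_zero`, `pullback_sliceLeft_quotK`, `pullback_sliceRight_quotK`.

Everything is proved; no named facts. No compactness is needed in this file.

## References

* A. Hatcher, *Vector Bundles and K-Theory* (v2.2, 2017), §2.1: Prop. 2.9, (2.7), p. 55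
  (the splitting `K̃(X × Y) ≅ K̃(X ∧ Y) ⊕ K̃(X) ⊕ K̃(Y)`), Thm. 2.11. [HatcherVBKT2017]
* D. Husemöller, *Fibre Bundles*, 3rd ed., GTM 20 (1994), Ch. 10 Prop. 2.1, Ch. 11 §1.
  [HusemollerFibreBundles1994]

## Design notes

* The extension hypothesis is stated for inverse pairs `(g, g')` of square matrices over
  `C(A, ℂ)` indexed by `Fin r`, which is what the descent argument consumes; no `GL`/units API.
* Used by the sphere case of Bott periodicity (`K̃(S²ⁿ⁺¹) = 0`) in
  `Literature/Topology/FourManifolds/HomotopySpheresStablyParallelizable*` (Bott's `π₆(SO(8)) = 0`).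
-/

noncomputable section

namespace Literature.AlgebraicTopology.KTheory

open Literature.RingTheory.KTheory Matrix Set TopologicalSpace

universe u v

/-! ### 1. The injectivity criterion -/

section Criterion

variable {X : Type u} [TopologicalSpace X] (A : Closeds X)

/-- Restricting a pulled-back function to `A` gives the constant `f(pt)`: as ring homomorphisms
`C(X/A, ℂ) → C(A, ℂ)`, `res_A ∘ q^* = const ∘ ev_pt`. [folklore] -/
theorem resHom_comp_comapRingHom_mk :
    (resHom (A : Set X)).comp (comapRingHom (Collapse.mk A)) =
      (constRingHom (A : Set X)).comp (evalRingHom (Collapse.pt A)) :=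
  RingHom.ext fun f ↦ ContinuousMap.ext fun a ↦ by
    change f (Collapse.mk A a) = f (Collapse.pt A)
    rw [Collapse.mk_eq_pt a.2]

/-- Matrix form of `resHom_comp_comapRingHom_mk`: `(q^* M)|_A` is the constant matrix `M(pt)`.
[folklore] -/
theorem map_mk_map_resHom {m n : Type*} (M : Matrix m n C(Collapse X A, ℂ)) :
    (M.map (comapRingHom (Collapse.mk A))).map (resHom (A : Set X)) =
      (M.map (evalRingHom (Collapse.pt A))).map (constRingHom (A : Set X)) := by
  rw [Matrix.map_map, Matrix.map_map, ← RingHom.coe_comp, ← RingHom.coe_comp, resHom_comp_comapRingHom_mk]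

variable {A}

/-- **Descent of a trivialisation** (the algebraic core of the injectivity of
`K̃(X/A) → K⁰(X)`; cf. Hatcher, *VBKT* Prop. 2.9, Husemöller Ch. 10 Prop. 2.1). Suppose every
inverse pair of `r × r` matrices over `C(A, ℂ)` extends to an inverse pair over `C(X, ℂ)`
(first component prescribed). If `p` is a matrix over `C(X/A, ℂ)` whose pull-back `q^* p` to `X`
is algebraically equivalent to `1ᵣ` and whose value `p(pt)` at the base point is algebraically
equivalent to `1ᵣ`, then `p ∼ 1ᵣ` over `C(X/A, ℂ)`. Proof: frames `x y = q^* p`, `y x = 1` over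
`X` and `x₀ y₀ = p(pt)`, `y₀ x₀ = 1` over `ℂ`; the transition `g = y|_A x₀` is invertible
(inverse `y₀ x|_A`), extends to `G`; the corrected frames `x G`, `G⁻¹ y` restrict to the
constants `x₀`, `y₀` on `A` and descend to `X/A`. [cite: HatcherVBKT2017, §2.1 Prop. 2.9] -/
theorem algEquivalent_one_of_quot {n r : Type*} [Fintype n] [Fintype r] [DecidableEq r]
    (hext : ∀ g g' : Matrix r r C((A : Set X), ℂ), g * g' = 1 → g' * g = 1 →
      ∃ G G' : Matrix r r C(X, ℂ), G * G' = 1 ∧ G' * G = 1 ∧ G.map (resHom (A : Set X)) = g)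
    {p : Matrix n n C(Collapse X A, ℂ)}
    (hP : AlgEquivalent (p.map (comapRingHom (Collapse.mk A))) (1 : Matrix r r C(X, ℂ)))
    (hE : AlgEquivalent (p.map (evalRingHom (Collapse.pt A))) (1 : Matrix r r ℂ)) :
    AlgEquivalent p (1 : Matrix r r C(Collapse X A, ℂ)) := by
  set ρ : C(X, ℂ) →+* C((A : Set X), ℂ) := resHom (A : Set X)
  set κ : ℂ →+* C((A : Set X), ℂ) := constRingHom (A : Set X)
  set P := p.map (comapRingHom (Collapse.mk A))
  set E := p.map (evalRingHom (Collapse.pt A))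
  have hPE : P.map ρ = E.map κ := map_mk_map_resHom A p
  have hp : IsIdempotentElem p :=
    matrix_eq_of_map_mk_eq (by rw [Matrix.map_mul]; exact hP.isIdempotentElem_left.eq)
      (by rw [Matrix.map_mul]; exact hE.isIdempotentElem_left.eq)
  obtain ⟨x, y, hxy, hyx, -, -, -, hyP⟩ := hP.exists_normalized
  obtain ⟨x₀, y₀, hxy₀, hyx₀, -, -, -, hy₀E⟩ := hE.exists_normalized
  -- the transition matrix over `A` and its inverse
  set g : Matrix r r C((A : Set X), ℂ) := y.map ρ * x₀.map κ
  set g' : Matrix r r C((A : Set X), ℂ) := y₀.map κ * x.map ρ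
  have hgg' : g * g' = 1 := by
    calc g * g' = y.map ρ * (x₀.map κ * y₀.map κ) * x.map ρ := by simp only [g, g', Matrix.mul_assoc]
      _ = y.map ρ * P.map ρ * x.map ρ := by rw [← Matrix.map_mul, hxy₀, hPE]
      _ = (y * P * x).map ρ := by rw [Matrix.map_mul, Matrix.map_mul]
      _ = 1 := by rw [hyP, hyx, Matrix.map_one _ (map_zero ρ) (map_one ρ)]
  have hg'g : g' * g = 1 := by
    calc g' * g = y₀.map κ * (x.map ρ * y.map ρ) * x₀.map κ := by simp only [g, g', Matrix.mul_assoc]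
      _ = y₀.map κ * E.map κ * x₀.map κ := by rw [← Matrix.map_mul, hxy, hPE]
      _ = (y₀ * E * x₀).map κ := by rw [Matrix.map_mul, Matrix.map_mul]
      _ = 1 := by rw [hy₀E, hyx₀, Matrix.map_one _ (map_zero κ) (map_one κ)]
  obtain ⟨G, G', hGG', hG'G, hGρ⟩ := hext g g' hgg' hg'g
  have hG'ρ : G'.map ρ = g' := by
    have h1 : G'.map ρ * g = 1 := by
      rw [← hGρ, ← Matrix.map_mul, hG'G, Matrix.map_one _ (map_zero ρ) (map_one ρ)]
    calc G'.map ρ = G'.map ρ * (g * g') := by rw [hgg', Matrix.mul_one]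
      _ = g' := by rw [← Matrix.mul_assoc, h1, Matrix.one_mul]
  -- the corrected frames
  set x' := x * G
  set y' := G' * y
  have hx'y' : x' * y' = P := by
    calc x' * y' = x * (G * G') * y := by simp only [x', y', Matrix.mul_assoc]
      _ = P := by rw [hGG', Matrix.mul_one, hxy]
  have hy'x' : y' * x' = 1 := by
    calc y' * x' = G' * (y * x) * G := by simp only [x', y', Matrix.mul_assoc]
      _ = 1 := by rw [hyx, Matrix.mul_one, hG'G]
  have hx'ρ : x'.map ρ = x₀.map κ := by
    calc x'.map ρ = x.map ρ * y.map ρ * x₀.map κ := by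
          rw [show x' = x * G from rfl, Matrix.map_mul, hGρ]; simp only [g, Matrix.mul_assoc]
      _ = P.map ρ * x₀.map κ := by rw [← Matrix.map_mul, hxy]
      _ = (E * x₀).map κ := by rw [hPE, Matrix.map_mul]
      _ = x₀.map κ := by rw [← hxy₀, Matrix.mul_assoc, hyx₀, Matrix.mul_one]
  have hy'ρ : y'.map ρ = y₀.map κ := by
    calc y'.map ρ = y₀.map κ * (x.map ρ * y.map ρ) := by
          rw [show y' = G' * y from rfl, Matrix.map_mul, hG'ρ]; simp only [g', Matrix.mul_assoc]
      _ = y₀.map κ * P.map ρ := by rw [← Matrix.map_mul, hxy]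
      _ = (y₀ * E).map κ := by rw [hPE, Matrix.map_mul]
      _ = y₀.map κ := by rw [hy₀E]
  -- descend the frames to `X/A`
  have hcx := apply_eq_of_map_resHom_eq hx'ρ
  have hcy := apply_eq_of_map_resHom_eq hy'ρ
  refine AlgEquivalent.of_mul_eq hp IsIdempotentElem.one (x := descendMatrix x' x₀ hcx)
    (y := descendMatrix y' y₀ hcy) ?_ ?_
  · exact matrix_eq_of_map_mk_eq
      (by rw [Matrix.map_mul, descendMatrix_map_mk, descendMatrix_map_mk, hx'y'])
      (by rw [Matrix.map_mul, descendMatrix_map_eval_pt, descendMatrix_map_eval_pt, hxy₀])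
  · exact matrix_eq_of_map_mk_eq
      (by rw [Matrix.map_mul, descendMatrix_map_mk, descendMatrix_map_mk, hy'x',
        Matrix.map_one _ (map_zero _) (map_one _)])
      (by rw [Matrix.map_mul, descendMatrix_map_eval_pt, descendMatrix_map_eval_pt, hyx₀,
        Matrix.map_one _ (map_zero _) (map_one _)])

/-- **Injectivity of `q^* : K̃(X/A) → K⁰(X)` under the extension property** (the case
"`K̃(SX) → K̃(SA)` onto" of the exact sequence of the pair; Hatcher, *VBKT* (2.7) and Prop. 2.9):
if every inverse pair of square matrices over `C(A, ℂ)` extends to an inverse pair over `C(X, ℂ)`,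
then a reduced class on `X/A` which pulls back to `0` on `X` is `0`. [cite: HatcherVBKT2017, §2.1 Prop. 2.9] -/
theorem eq_zero_of_quotK_eq_zero
    (hext : ∀ (r : ℕ) (g g' : Matrix (Fin r) (Fin r) C((A : Set X), ℂ)), g * g' = 1 → g' * g = 1 →
      ∃ G G' : Matrix (Fin r) (Fin r) C(X, ℂ), G * G' = 1 ∧ G' * G = 1 ∧ G.map (resHom (A : Set X)) = g)
    {b : K0 (Collapse X A)} (hb : b ∈ Reduced (Collapse X A) (Collapse.pt A)) (h0 : quotK A b = 0) :
    b = 0 := by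
  obtain ⟨p, p₀, rfl⟩ := KZero.exists_of_sub_of b
  -- rewrite `b = [p ⊕ (1 - p₀)] - [1_N]`
  set N := p₀.size
  set p₁ : Idem C(Collapse X A, ℂ) := p + p₀.compl
  have hb' : KZero.of p - KZero.of p₀ = KZero.of p₁ - KZero.of (Idem.unit N : Idem C(Collapse X A, ℂ)) := by
    rw [KZero.of_add, ← KZero.of_add_of_compl p₀]; abel
  rw [hb'] at hb h0 ⊢
  -- `q^* p₁` is stably trivial of rank `N`
  have hq : KZero.of (p₁.map (comapRingHom (Collapse.mk A))) = KZero.of (Idem.unit N) := by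
    rw [map_sub, sub_eq_zero, pullback_of, pullback_of, Idem.map_unit] at h0
    exact h0
  obtain ⟨m, hm⟩ := KZero.of_eq_of_iff_exists_unit.1 hq
  rw [Idem.unit_add_unit] at hm
  set p₂ : Idem C(Collapse X A, ℂ) := Idem.unit m + p₁
  have hP : AlgEquivalent (p₂.mat.map (comapRingHom (Collapse.mk A)))
      (1 : Matrix (Fin (m + N)) (Fin (m + N)) C(X, ℂ)) := by
    have h1 : p₂.map (comapRingHom (Collapse.mk A)) = Idem.unit m + p₁.map (comapRingHom (Collapse.mk A)) := by
      rw [Idem.map_add, Idem.map_unit]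
    have h2 := Idem.equiv_iff.1 hm
    rw [← h1] at h2
    exact h2
  -- the rank of `p₂` at the base point is `m + N`
  have hrank : (p₁.map (evalRingHom (Collapse.pt A))).rank = N := by
    have h := mem_reduced_iff.1 hb
    rw [map_sub, rankAt_of, rankAt_of_unit, sub_eq_zero, Nat.cast_inj] at h
    exact h
  have hE : AlgEquivalent (p₂.mat.map (evalRingHom (Collapse.pt A))) (1 : Matrix (Fin (m + N)) (Fin (m + N)) ℂ) := by
    have h1 : p₂.map (evalRingHom (Collapse.pt A)) = Idem.unit m + p₁.map (evalRingHom (Collapse.pt A)) := by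
      rw [Idem.map_add, Idem.map_unit]
    have h2 : (p₂.map (evalRingHom (Collapse.pt A))).rank = m + N := by
      rw [h1, Idem.rank_add, Idem.rank_unit, hrank]
    exact Idem.equiv_iff.1 (Idem.rank_eq_iff.1 h2)
  have key : AlgEquivalent p₂.mat (1 : Matrix (Fin (m + N)) (Fin (m + N)) C(Collapse X A, ℂ)) :=
    algEquivalent_one_of_quot (hext (m + N)) hP hE
  have hof : KZero.of p₂ = KZero.of (Idem.unit (m + N) : Idem C(Collapse X A, ℂ)) := KZero.of_eq_of key
  have hp₁ : KZero.of p₁ = KZero.of p₂ - KZero.of (Idem.unit m : Idem C(Collapse X A, ℂ)) := by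
    have h : KZero.of p₂ = KZero.of (Idem.unit m : Idem C(Collapse X A, ℂ)) + KZero.of p₁ := KZero.of_add _ _
    rw [h]; abel
  rw [hp₁, hof, ← Idem.unit_add_unit, KZero.of_add]
  abel

end Criterion

/-! ### 2. The wedge `X ∨ Y ⊆ X × Y` and the extension property -/

section Wedge

variable {X : Type u} {Y : Type v}

/-- The **wedge** `X ∨ Y = X × {y₀} ∪ {x₀} × Y` inside the product `X × Y`.
[cite: HatcherVBKT2017, §2.1 p. 55] -/
def prodWedge (x₀ : X) (y₀ : Y) : Set (X × Y) := {p | p.1 = x₀ ∨ p.2 = y₀}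

/-- Membership in the wedge. [folklore] -/
theorem mem_prodWedge {x₀ : X} {y₀ : Y} {p : X × Y} : p ∈ prodWedge x₀ y₀ ↔ p.1 = x₀ ∨ p.2 = y₀ := Iff.rfl

variable [TopologicalSpace X] [TopologicalSpace Y]

/-- The wedge is closed (points being closed). [folklore] -/
theorem isClosed_prodWedge [T1Space X] [T1Space Y] (x₀ : X) (y₀ : Y) : IsClosed (prodWedge x₀ y₀) := by
  have h1 : IsClosed (Prod.fst ⁻¹' ({x₀} : Set X) : Set (X × Y)) := isClosed_singleton.preimage continuous_fst
  have h2 : IsClosed (Prod.snd ⁻¹' ({y₀} : Set Y) : Set (X × Y)) := isClosed_singleton.preimage continuous_snd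
  exact h1.union h2

/-- The wedge as a closed subset of `X × Y`. [cite: HatcherVBKT2017, §2.1 p. 55] -/
def prodWedgeC [T1Space X] [T1Space Y] (x₀ : X) (y₀ : Y) : Closeds (X × Y) :=
  ⟨prodWedge x₀ y₀, isClosed_prodWedge x₀ y₀⟩

/-- The underlying set of `prodWedgeC`. [folklore] -/
@[simp] theorem coe_prodWedgeC [T1Space X] [T1Space Y] (x₀ : X) (y₀ : Y) :
    ((prodWedgeC x₀ y₀ : Closeds (X × Y)) : Set (X × Y)) = prodWedge x₀ y₀ := rfl

/-- The base point `(x₀, y₀)` of the wedge. [folklore] -/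
def prodWedgeBase (x₀ : X) (y₀ : Y) : ↥(prodWedge x₀ y₀) := ⟨(x₀, y₀), Or.inl rfl⟩

/-- The retraction `(x, y) ↦ (x, y₀)` of `X × Y` onto the first leg of the wedge. [folklore] -/
def toWedgeLeft (x₀ : X) (y₀ : Y) : C(X × Y, ↥(prodWedge x₀ y₀)) :=
  ⟨fun p ↦ ⟨(p.1, y₀), Or.inr rfl⟩, (continuous_fst.prodMk continuous_const).subtype_mk _⟩

/-- The retraction `(x, y) ↦ (x₀, y)` of `X × Y` onto the second leg of the wedge. [folklore] -/
def toWedgeRight (x₀ : X) (y₀ : Y) : C(X × Y, ↥(prodWedge x₀ y₀)) :=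
  ⟨fun p ↦ ⟨(x₀, p.2), Or.inl rfl⟩, (continuous_const.prodMk continuous_snd).subtype_mk _⟩

/-- Evaluation after the constant embedding is the identity. [folklore] -/
theorem evalRingHom_comp_constRingHom {Z : Type*} [TopologicalSpace Z] (z : Z) :
    (evalRingHom z).comp (constRingHom Z) = RingHom.id ℂ :=
  RingHom.ext fun _ ↦ rfl

/-- Two matrices of functions agree iff they agree at every point. [folklore] -/
theorem matrix_eq_of_forall_map_evalRingHom {Z : Type*} [TopologicalSpace Z] {m n : Type*}
    {M N : Matrix m n C(Z, ℂ)} (h : ∀ z, M.map (evalRingHom z) = N.map (evalRingHom z)) : M = N := by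
  ext i j z
  exact congrFun (congrFun (h z) i) j

/-- **Invertible matrices of functions on the wedge extend to the product**:
`G(x, y) = g(x, y₀) · g(x₀, y₀)⁻¹ · g(x₀, y)` (with inverse `g⁻¹(x₀, y) g(x₀, y₀) g⁻¹(x, y₀)`)
restricts to `g` on `X × {y₀} ∪ {x₀} × Y`. This is the elementary reason why
`K̃(S(X × Y)) → K̃(S(X ∨ Y))` is onto and `K̃(X ∧ Y) → K̃(X × Y)` is injective (Hatcher, *VBKT*,
p. 55). [cite: HatcherVBKT2017, §2.1 p. 55] -/
theorem exists_extend_prodWedge (x₀ : X) (y₀ : Y) {r : Type*} [Fintype r] [DecidableEq r]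
    (g g' : Matrix r r C(↥(prodWedge x₀ y₀), ℂ)) (hgg' : g * g' = 1) (hg'g : g' * g = 1) :
    ∃ G G' : Matrix r r C(X × Y, ℂ), G * G' = 1 ∧ G' * G = 1 ∧ G.map (resHom (prodWedge x₀ y₀)) = g := by
  set α : C(↥(prodWedge x₀ y₀), ℂ) →+* C(X × Y, ℂ) := comapRingHom (toWedgeLeft x₀ y₀)
  set β : C(↥(prodWedge x₀ y₀), ℂ) →+* C(X × Y, ℂ) := comapRingHom (toWedgeRight x₀ y₀)
  set γ : C(↥(prodWedge x₀ y₀), ℂ) →+* C(X × Y, ℂ) := (constRingHom (X × Y)).comp (evalRingHom (prodWedgeBase x₀ y₀))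
  refine ⟨g.map α * g'.map γ * g.map β, g'.map β * g.map γ * g'.map α, ?_, ?_, ?_⟩
  · calc g.map α * g'.map γ * g.map β * (g'.map β * g.map γ * g'.map α)
          = g.map α * (g'.map γ * ((g.map β * g'.map β) * g.map γ)) * g'.map α := by simp only [Matrix.mul_assoc]
      _ = 1 := by
          rw [← Matrix.map_mul, hgg', Matrix.map_one _ (map_zero β) (map_one β), Matrix.one_mul, ← Matrix.map_mul,
            hg'g, Matrix.map_one _ (map_zero γ) (map_one γ), Matrix.mul_one, ← Matrix.map_mul, hgg',
            Matrix.map_one _ (map_zero α) (map_one α)]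
  · calc g'.map β * g.map γ * g'.map α * (g.map α * g'.map γ * g.map β)
          = g'.map β * (g.map γ * ((g'.map α * g.map α) * g'.map γ)) * g.map β := by simp only [Matrix.mul_assoc]
      _ = 1 := by
          rw [← Matrix.map_mul, hg'g, Matrix.map_one _ (map_zero α) (map_one α), Matrix.one_mul, ← Matrix.map_mul,
            hgg', Matrix.map_one _ (map_zero γ) (map_one γ), Matrix.mul_one, ← Matrix.map_mul, hg'g,
            Matrix.map_one _ (map_zero β) (map_one β)]
  · refine matrix_eq_of_forall_map_evalRingHom fun w ↦ ?_
    -- evaluate the three factors at a point `w` of the wedge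
    have hα : ∀ M : Matrix r r C(↥(prodWedge x₀ y₀), ℂ), ((M.map α).map (resHom (prodWedge x₀ y₀))).map (evalRingHom w) =
        M.map (evalRingHom (toWedgeLeft x₀ y₀ w.1)) := fun M ↦ by
      rw [Matrix.map_map, Matrix.map_map, ← RingHom.coe_comp, ← RingHom.coe_comp]; rfl
    have hβ : ∀ M : Matrix r r C(↥(prodWedge x₀ y₀), ℂ), ((M.map β).map (resHom (prodWedge x₀ y₀))).map (evalRingHom w) =
        M.map (evalRingHom (toWedgeRight x₀ y₀ w.1)) := fun M ↦ by
      rw [Matrix.map_map, Matrix.map_map, ← RingHom.coe_comp, ← RingHom.coe_comp]; rfl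
    have hγ : ∀ M : Matrix r r C(↥(prodWedge x₀ y₀), ℂ), ((M.map γ).map (resHom (prodWedge x₀ y₀))).map (evalRingHom w) =
        M.map (evalRingHom (prodWedgeBase x₀ y₀)) := fun M ↦ by
      rw [Matrix.map_map, Matrix.map_map, ← RingHom.coe_comp, ← RingHom.coe_comp,
        show ((evalRingHom w).comp (resHom (prodWedge x₀ y₀))).comp γ =
          (((evalRingHom w).comp (resHom (prodWedge x₀ y₀))).comp (constRingHom (X × Y))).comp
            (evalRingHom (prodWedgeBase x₀ y₀)) from rfl]
      have hc : ((evalRingHom w).comp (resHom (prodWedge x₀ y₀))).comp (constRingHom (X × Y)) = RingHom.id ℂ :=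
        RingHom.ext fun _ ↦ rfl
      rw [hc, RingHom.id_comp]
    rw [Matrix.map_mul, Matrix.map_mul, Matrix.map_mul, Matrix.map_mul, hα, hβ, hγ]
    obtain ⟨⟨x, y⟩, hw⟩ := w
    rcases hw with hx | hy
    · -- `w = (x₀, y)`: the first two factors cancel
      change x = x₀ at hx
      subst hx
      have hl : toWedgeLeft x y₀ (x, y) = prodWedgeBase x y₀ := rfl
      have hr : toWedgeRight x y₀ (x, y) = ⟨(x, y), Or.inl rfl⟩ := rfl
      rw [hl, hr, ← Matrix.map_mul, hgg', Matrix.map_one _ (map_zero _) (map_one _), Matrix.one_mul]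
    · -- `w = (x, y₀)`: the last two factors cancel
      change y = y₀ at hy
      subst hy
      have hl : toWedgeLeft x₀ y (x, y) = ⟨(x, y), Or.inr rfl⟩ := rfl
      have hr : toWedgeRight x₀ y (x, y) = prodWedgeBase x₀ y := rfl
      rw [hl, hr, Matrix.mul_assoc, ← Matrix.map_mul, hg'g, Matrix.map_one _ (map_zero _) (map_one _), Matrix.mul_one]

variable [T1Space X] [T1Space Y]

/-- **`q^* : K̃((X × Y)/(X ∨ Y)) → K⁰(X × Y)` is injective** (Hatcher, *VBKT* p. 55: the exact
sequence of the pair `(X × Y, X ∨ Y)` splits). [cite: HatcherVBKT2017, §2.1 p. 55] -/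
theorem eq_zero_of_quotK_prodWedge_eq_zero (x₀ : X) (y₀ : Y) {b : K0 (Collapse (X × Y) (prodWedgeC x₀ y₀))}
    (hb : b ∈ Reduced (Collapse (X × Y) (prodWedgeC x₀ y₀)) (Collapse.pt (prodWedgeC x₀ y₀)))
    (h0 : quotK (prodWedgeC x₀ y₀) b = 0) : b = 0 :=
  eq_zero_of_quotK_eq_zero (fun _ g g' hgg' hg'g ↦ exists_extend_prodWedge x₀ y₀ g g' hgg' hg'g) hb h0

/-- The slice `X × {y₀}` lies in the wedge: `(x ↦ (x, y₀)) = incl ∘ (x ↦ ⟨(x, y₀), _⟩)`. [folklore] -/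
theorem sliceLeft_eq_incl_comp (x₀ : X) (y₀ : Y) :
    (ContinuousMap.id X).prodMk (ContinuousMap.const X y₀) =
      (incl (prodWedgeC x₀ y₀ : Set (X × Y))).comp
        ⟨fun x ↦ ⟨(x, y₀), Or.inr rfl⟩, (continuous_id.prodMk continuous_const).subtype_mk _⟩ := rfl

/-- The slice `{x₀} × Y` lies in the wedge. [folklore] -/
theorem sliceRight_eq_incl_comp (x₀ : X) (y₀ : Y) :
    (ContinuousMap.const Y x₀).prodMk (ContinuousMap.id Y) =
      (incl (prodWedgeC x₀ y₀ : Set (X × Y))).comp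
        ⟨fun y ↦ ⟨(x₀, y), Or.inl rfl⟩, (continuous_const.prodMk continuous_id).subtype_mk _⟩ := rfl

/-- A reduced class on `(X × Y)/(X ∨ Y)` pulls back to `0` on the slice `X × {y₀}`. [cite: HatcherVBKT2017, §2.1 p. 55] -/
theorem pullback_sliceLeft_quotK (x₀ : X) (y₀ : Y) {b : K0 (Collapse (X × Y) (prodWedgeC x₀ y₀))}
    (hb : b ∈ Reduced (Collapse (X × Y) (prodWedgeC x₀ y₀)) (Collapse.pt (prodWedgeC x₀ y₀))) :
    pullback ((ContinuousMap.id X).prodMk (ContinuousMap.const X y₀)) (quotK (prodWedgeC x₀ y₀) b) = 0 := by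
  rw [sliceLeft_eq_incl_comp x₀ y₀, pullback_comp, AddMonoidHom.comp_apply]
  change pullback _ (resK (prodWedgeC x₀ y₀) (quotK (prodWedgeC x₀ y₀) b)) = 0
  rw [resK_quotK_of_mem_reduced _ hb, map_zero]

/-- A reduced class on `(X × Y)/(X ∨ Y)` pulls back to `0` on the slice `{x₀} × Y`. [cite: HatcherVBKT2017, §2.1 p. 55] -/
theorem pullback_sliceRight_quotK (x₀ : X) (y₀ : Y) {b : K0 (Collapse (X × Y) (prodWedgeC x₀ y₀))}
    (hb : b ∈ Reduced (Collapse (X × Y) (prodWedgeC x₀ y₀)) (Collapse.pt (prodWedgeC x₀ y₀))) :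
    pullback ((ContinuousMap.const Y x₀).prodMk (ContinuousMap.id Y)) (quotK (prodWedgeC x₀ y₀) b) = 0 := by
  rw [sliceRight_eq_incl_comp x₀ y₀, pullback_comp, AddMonoidHom.comp_apply]
  change pullback _ (resK (prodWedgeC x₀ y₀) (quotK (prodWedgeC x₀ y₀) b)) = 0
  rw [resK_quotK_of_mem_reduced _ hb, map_zero]

end Wedge

end Literature.AlgebraicTopology.KTheory

end
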